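import Summits.CriticalPhenomena.PercolationContinuityZ3.Theorems.PercNearOneGluingAdditiveGluingBlockGoodTwoRelays
import HarnessLib

/-! # Crux `PercNearOneGluing.AdditiveGluing` (stmt-CriticalPhenomena-4576), kernel `stub_blockGoodTwo` at THREE relays:
# block goodness against the un-glued minimiser up to the DOUBLE-HIT defect

TTRL deep seat `ttrlatt-v1433-d0` (variant V1433 = the registered kernel `stub_blockGoodTwo` at its first open relay
count `A.card = 4`).  Lands `--supports stmt-CriticalPhenomena-4576`; no definitions, no named facts.

**Theorem (`blockGood_threeRelays_doubleHit`).**  `μ = prodBernoulli u` on the bond configurations of `Fin n`; relays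
`A ⊆ {a₀, a₂, a₃, b}` with `b, a₀, a₂, a₃ ∈ A`; `a₀` a minimiser of `μ(· ↔ b)` over `A` in the UN-GLUED graph; `S ≠ ∅` any
block, `K_S = ⋃_{s∈S} C(s)` its cluster; `sel W ∈ A` any selection.  Then
`μ(a₀ ↔ b) + μ(a₀ ↮ b, a₀ ↔ S, S ↔ b) ≤ μ(S ↔ b) + Σ_{W ∩ A = ∅} μ(K_S = W) · μ(sel W ↔ b in Wᶜ) + μ(Dbl)`,
with the **double-hit defect** `Dbl = {a₀ ∉ K_S, a₂ ∈ K_S, a₃ ∈ K_S, a₂ ↔ b, a₃ ↔ b}`.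
So the three-relay kernel (`stub_blockGoodTwo` at `A.card = 4`, whose point-observer special case is Kozma–Nitzan's
Question 7 for three relays) holds OFF the event that the block reaches both non-designated relays while missing `a₀`
(`blockGoodTwo_cardFour_of_noDoubleHit`), and in general its possible failure is bounded by `μ(Dbl)`: the double hit is
the irreducible core of the kernel.
Proof: the exchange normal form at `a₀` and pocket Markov (as in the two-relay drift theorem `blockGood_twoRelays`),
then Kozma–Nitzan's Lemma 3 for the observer SET `S` (`SandwichSet.lemma3_sandwich_set`) TWICE — against `a₂` on the
sandwich family `{a₂ ∈ K_S ∌ a₀} ∪ {K_S = W : W dead, f₂ < f₀, f₂ ≤ f₃}` and against `a₃` on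
`{a₃ ∈ K_S ∌ a₀} ∪ {K_S = W : W dead, f₃ < f₀, f₃ < f₂}` (`f_a(W) = μ(K_S = W, a ↔ b)`); the two comparisons overlap
exactly on `Dbl`.
[cite: KozmaNitzan2024, §3.1 Thm 2 (pp. 8–9), §3.2 (Definition p. 12), Lemma 3 (pp. 6–7), Question 7 (p. 36)]
-/

namespace Summit.CriticalPhenomena.PercolationContinuityZ3.Theorems

open MeasureTheory Set
open Literature.Probability.LatticeModels (prodBernoulli)
open Literature.Probability.Percolation (BondConfig openConn openConnIn openGraph openCluster)
open scoped BigOperators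

noncomputable section
open Classical

section BlockGoodThreeRelays

open Literature.Probability.LatticeModels Literature.Probability.Percolation

variable {n : ℕ}

/-- **Three-relay block goodness against the un-glued minimiser, up to the double-hit defect.**
See the module docstring. [cite: KozmaNitzan2024, §3.2 (Definition p. 12), Lemma 3 (pp. 6–7), Question 7 (p. 36)] -/
theorem blockGood_threeRelays_doubleHit (u : Sym2 (Fin n) → unitInterval) (A S : Finset (Fin n))
    (b a₀ a₂ a₃ : Fin n) (sel : Finset (Fin n) → Fin n) (hbA : b ∈ A) (ha₀ : a₀ ∈ A) (ha₂ : a₂ ∈ A) (ha₃ : a₃ ∈ A)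
    (hA : ∀ a ∈ A, a = a₀ ∨ a = a₂ ∨ a = a₃ ∨ a = b) (hS : S.Nonempty)
    (hsel : ∀ W, sel W ∈ A)
    (hmin : ∀ a ∈ A, (prodBernoulli u).real (openConn a₀ b) ≤ (prodBernoulli u).real (openConn a b)) :
    (prodBernoulli u).real (openConn a₀ b)
        + (prodBernoulli u).real
            ((openConn a₀ b)ᶜ ∩ (⋃ s ∈ S, openConn a₀ s) ∩ (⋃ s ∈ S, openConn s b))
      ≤ (prodBernoulli u).real (⋃ s ∈ S, openConn s b)
        + ∑ W ∈ (Finset.univ : Finset (Finset (Fin n))).filter (fun W => Disjoint W A),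
            (prodBernoulli u).real {ω : BondConfig (Fin n) | ∀ z : Fin n, (z ∈ W ↔ ω ∈ ⋃ s ∈ S, openConn s z)}
              * (prodBernoulli u).real (openConnIn ((W : Set (Fin n))ᶜ) (sel W) b)
        + (prodBernoulli u).real
            ((⋃ s ∈ S, openConn s a₀)ᶜ ∩ (⋃ s ∈ S, openConn s a₂) ∩ (⋃ s ∈ S, openConn s a₃)
              ∩ openConn a₂ b ∩ openConn a₃ b) := by
  set μ := prodBernoulli u with hμ
  have hms : ∀ s : Set (BondConfig (Fin n)), MeasurableSet s := fun _ => MeasurableSet.of_discrete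
  -- notation
  set KW : Finset (Fin n) → Set (BondConfig (Fin n)) :=
    fun W => {ω : BondConfig (Fin n) | ∀ z : Fin n, (z ∈ W ↔ ω ∈ ⋃ s ∈ S, openConn s z)} with hKW
  set Y : Set (BondConfig (Fin n)) := ⋃ s ∈ S, openConn s b with hY
  set Xs : Set (BondConfig (Fin n)) := ⋃ s ∈ S, openConn a₀ s with hXs
  set A2 : Set (BondConfig (Fin n)) := ⋃ s ∈ S, openConn s a₂ with hA2
  set A3 : Set (BondConfig (Fin n)) := ⋃ s ∈ S, openConn s a₃ with hA3
  set 𝒟 : Finset (Finset (Fin n)) := (Finset.univ : Finset (Finset (Fin n))).filter (fun W => Disjoint W A) with h𝒟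
  set f₀ : Finset (Fin n) → ℝ := fun W => μ.real (KW W ∩ openConn a₀ b) with hf₀
  set f₂ : Finset (Fin n) → ℝ := fun W => μ.real (KW W ∩ openConn a₂ b) with hf₂
  set f₃ : Finset (Fin n) → ℝ := fun W => μ.real (KW W ∩ openConn a₃ b) with hf₃
  have hXs' : Xs = ⋃ s ∈ S, openConn s a₀ := by
    simp only [hXs, knThm2_openConn_comm a₀]
  have hmemXs : ∀ ω, ω ∈ Xs ↔ ∃ s ∈ S, (openGraph ω).Reachable a₀ s := fun ω => by
    simp only [hXs, Set.mem_iUnion, exists_prop]; exact Iff.rfl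
  have hmemY : ∀ ω, ω ∈ Y ↔ ∃ s ∈ S, (openGraph ω).Reachable s b := fun ω => by
    simp only [hY, Set.mem_iUnion, exists_prop]; exact Iff.rfl
  have hmemA2 : ∀ ω, ω ∈ A2 ↔ ∃ s ∈ S, (openGraph ω).Reachable s a₂ := fun ω => by
    simp only [hA2, Set.mem_iUnion, exists_prop]; exact Iff.rfl
  have hmemA3 : ∀ ω, ω ∈ A3 ↔ ∃ s ∈ S, (openGraph ω).Reachable s a₃ := fun ω => by
    simp only [hA3, Set.mem_iUnion, exists_prop]; exact Iff.rfl
  have hmem𝒟 : ∀ W, W ∈ 𝒟 ↔ Disjoint W A := fun W => by simp [h𝒟]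
  -- (S1) each pocket term is at least `min(f₀, f₂, f₃)`
  have hterm : ∀ W ∈ 𝒟, min (min (f₀ W) (f₂ W)) (f₃ W)
      ≤ μ.real (KW W) * μ.real (openConnIn ((W : Set (Fin n))ᶜ) (sel W) b) := by
    intro W hW
    have hWA : Disjoint W A := (hmem𝒟 W).1 hW
    have hselW : sel W ∉ W := fun h => Finset.disjoint_left.1 hWA h (hsel W)
    rw [show μ.real (KW W) * μ.real (openConnIn ((W : Set (Fin n))ᶜ) (sel W) b) = μ.real (KW W ∩ openConn (sel W) b)
      from blockPocket_mul_offConn u S W hS (sel W) b hselW]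
    rcases hA (sel W) (hsel W) with h | h | h | h
    · rw [h]; exact (min_le_left _ _).trans (min_le_left _ _)
    · rw [h]; exact (min_le_left _ _).trans (min_le_right _ _)
    · rw [h]; exact min_le_right _ _
    · rw [h]
      refine ((min_le_left _ _).trans (min_le_left _ _)).trans
        (measureReal_mono (Set.inter_subset_inter_right _ fun ω _ => ?_) (measure_ne_top _ _))
      exact (SimpleGraph.Reachable.refl b : (openGraph ω).Reachable b b)
  have hsum1 : ∑ W ∈ 𝒟, min (min (f₀ W) (f₂ W)) (f₃ W) ≤
      ∑ W ∈ 𝒟, μ.real (KW W) * μ.real (openConnIn ((W : Set (Fin n))ᶜ) (sel W) b) := Finset.sum_le_sum hterm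
  -- (S2) the dead part of `τ(a₀)` is the fibre sum of `f₀`
  have hP3 : μ.real (openConn a₀ b ∩ Yᶜ ∩ (A2 ∪ A3)ᶜ) = ∑ W ∈ 𝒟, f₀ W := by
    have h := blockPocket_sum_dead u S A (openConn a₀ b)
    simp only [hf₀, h𝒟, hKW]
    rw [h]
    congr 1; ext ω
    simp only [Set.mem_inter_iff, Set.mem_compl_iff, Set.mem_union, Set.mem_setOf_eq, hmemY, hmemA2, hmemA3,
      Set.mem_iUnion, exists_prop, not_exists, not_and, not_or]
    constructor
    · rintro ⟨⟨hab, hYc⟩, hA2c, hA3c⟩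
      refine ⟨hab, fun a ha s hs hsa => ?_⟩
      rcases hA a ha with rfl | rfl | rfl | rfl
      · exact hYc s hs (hsa.trans hab)
      · exact hA2c s hs hsa
      · exact hA3c s hs hsa
      · exact hYc s hs hsa
    · rintro ⟨hab, hdead⟩
      exact ⟨⟨hab, fun s hs hsb => hdead b hbA s hs hsb⟩, fun s hs hsa => hdead a₂ ha₂ s hs hsa,
        fun s hs hsa => hdead a₃ ha₃ s hs hsa⟩
  -- (S3) `τ(a₀) = P1 + P2 + P3`
  have hτ : μ.real (openConn a₀ b) = μ.real (openConn a₀ b ∩ Y) + μ.real (openConn a₀ b ∩ Yᶜ ∩ (A2 ∪ A3))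
      + μ.real (openConn a₀ b ∩ Yᶜ ∩ (A2 ∪ A3)ᶜ) := by
    have e1 := measureReal_inter_add_sdiff (μ := μ) (s := openConn a₀ b) (hms Y) (measure_ne_top _ _)
    have e2 := measureReal_inter_add_sdiff (μ := μ) (s := openConn a₀ b ∩ Yᶜ) (hms (A2 ∪ A3)) (measure_ne_top _ _)
    rw [Set.sdiff_eq] at e1 e2
    linarith
  -- (S4) `μ(Y) = Q1 + Q2 + Q3`
  have hYd : μ.real Y = μ.real (openConn a₀ b ∩ Y)
      + μ.real ((openConn a₀ b)ᶜ ∩ Xs ∩ Y) + μ.real (Y ∩ (openConn a₀ b)ᶜ ∩ Xsᶜ) := by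
    have e1 := measureReal_inter_add_sdiff (μ := μ) (s := Y) (hms (openConn a₀ b)) (measure_ne_top _ _)
    have e2 := measureReal_inter_add_sdiff (μ := μ) (s := Y ∩ (openConn a₀ b)ᶜ) (hms Xs) (measure_ne_top _ _)
    rw [Set.sdiff_eq] at e1 e2
    rw [Set.inter_comm Y (openConn a₀ b)] at e1
    have e3 : Y ∩ (openConn a₀ b)ᶜ ∩ Xs = (openConn a₀ b)ᶜ ∩ Xs ∩ Y := by
      ext ω; simp only [Set.mem_inter_iff]; tauto
    rw [e3] at e2
    linarith
  -- (S5) `Q3 + μ(Dbl) ≥ μ(a₂↔b, a₂ ∈ K_S ∌ a₀) + μ(a₃↔b, a₃ ∈ K_S ∌ a₀)` (the two pieces overlap exactly on `Dbl`)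
  have hQ3 : μ.real (openConn a₂ b ∩ (A2 ∩ Xsᶜ)) + μ.real (openConn a₃ b ∩ (A3 ∩ Xsᶜ))
      ≤ μ.real (Y ∩ (openConn a₀ b)ᶜ ∩ Xsᶜ)
        + μ.real ((⋃ s ∈ S, openConn s a₀)ᶜ ∩ (⋃ s ∈ S, openConn s a₂) ∩ (⋃ s ∈ S, openConn s a₃)
            ∩ openConn a₂ b ∩ openConn a₃ b) := by
    rw [← measureReal_union_add_inter (μ := μ) (s := openConn a₂ b ∩ (A2 ∩ Xsᶜ))
      (hms (openConn a₃ b ∩ (A3 ∩ Xsᶜ))) (measure_ne_top _ _) (measure_ne_top _ _)]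
    refine add_le_add (measureReal_mono (fun ω hω => ?_) (measure_ne_top _ _))
      (measureReal_mono (fun ω hω => ?_) (measure_ne_top _ _))
    · simp only [Set.mem_union, Set.mem_inter_iff, Set.mem_compl_iff, hmemY, hmemA2, hmemA3, hmemXs, not_exists,
        not_and] at hω ⊢
      rcases hω with ⟨h2b, ⟨s, hs, hs2⟩, hXc⟩ | ⟨h3b, ⟨s, hs, hs3⟩, hXc⟩
      · refine ⟨⟨⟨s, hs, hs2.trans h2b⟩, fun hab => hXc s hs ?_⟩, hXc⟩
        exact (show (openGraph ω).Reachable a₀ b from hab).trans (hs2.trans h2b).symm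
      · refine ⟨⟨⟨s, hs, hs3.trans h3b⟩, fun hab => hXc s hs ?_⟩, hXc⟩
        exact (show (openGraph ω).Reachable a₀ b from hab).trans (hs3.trans h3b).symm
    · rw [← hXs']
      simp only [Set.mem_inter_iff, Set.mem_compl_iff] at hω ⊢
      obtain ⟨⟨h2b, hA2ω, hXc⟩, h3b, hA3ω, -⟩ := hω
      exact ⟨⟨⟨⟨hXc, hA2ω⟩, hA3ω⟩, h2b⟩, h3b⟩
  -- (S6) `P2 ≤ μ(a₀↔b, a₂ ∈ K_S, a₀ ∉ K_S) + μ(a₀↔b, a₃ ∈ K_S, a₀ ∉ K_S)`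
  have hP2 : μ.real (openConn a₀ b ∩ Yᶜ ∩ (A2 ∪ A3))
      ≤ μ.real (openConn a₀ b ∩ (A2 ∩ Xsᶜ)) + μ.real (openConn a₀ b ∩ (A3 ∩ Xsᶜ)) := by
    refine (measureReal_mono (fun ω hω => ?_) (measure_ne_top _ _)).trans (measureReal_union_le _ _)
    simp only [Set.mem_union, Set.mem_inter_iff, Set.mem_compl_iff, hmemY, hmemA2, hmemA3, hmemXs, not_exists,
      not_and] at hω ⊢
    obtain ⟨⟨hab, hYc⟩, hA23⟩ := hω
    have hXc : ∀ s ∈ S, ¬ (openGraph ω).Reachable a₀ s := fun s hs h0s => hYc s hs (h0s.symm.trans hab)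
    rcases hA23 with hA2ω | hA3ω
    · exact Or.inl ⟨hab, hA2ω, hXc⟩
    · exact Or.inr ⟨hab, hA3ω, hXc⟩
  -- (S7) Lemma 3 for the observer set `S`, twice
  set R₂ : Finset (Finset (Fin n)) := 𝒟.filter (fun W => f₂ W < f₀ W ∧ f₂ W ≤ f₃ W) with hR₂
  set R₃ : Finset (Finset (Fin n)) := 𝒟.filter (fun W => f₃ W < f₀ W ∧ f₃ W < f₂ W) with hR₃
  have hR₂A : ∀ W ∈ R₂, Disjoint W A := fun W hW => (hmem𝒟 W).1 (Finset.mem_filter.1 hW).1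
  have hR₃A : ∀ W ∈ R₃, Disjoint W A := fun W hW => (hmem𝒟 W).1 (Finset.mem_filter.1 hW).1
  have hR₂a₂ : ∀ W ∈ R₂, a₂ ∉ W := fun W hW h => Finset.disjoint_left.1 (hR₂A W hW) h ha₂
  have hR₃a₃ : ∀ W ∈ R₃, a₃ ∉ W := fun W hW h => Finset.disjoint_left.1 (hR₃A W hW) h ha₃
  -- against `a₂`
  set 𝓕₂ : Set (Set (Fin n)) := {T : Set (Fin n) | a₂ ∈ T ∧ a₀ ∉ T} ∪ {T | ∃ W ∈ R₂, T = (W : Set (Fin n))} with h𝓕₂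
  have hlo₂ : ∀ ω : BondConfig (Fin n), a₂ ∈ (⋃ s ∈ S, openCluster ω s) → a₀ ∉ (⋃ s ∈ S, openCluster ω s) →
      (⋃ s ∈ S, openCluster ω s) ∈ 𝓕₂ := fun ω h2 h0 => Or.inl ⟨h2, h0⟩
  have hhi₂ : ∀ ω : BondConfig (Fin n), (⋃ s ∈ S, openCluster ω s) ∈ 𝓕₂ → a₀ ∉ (⋃ s ∈ S, openCluster ω s) := by
    rintro ω (⟨-, h0⟩ | ⟨W, hW, hWe⟩)
    · exact h0
    · rw [hWe]
      exact fun h => Finset.disjoint_left.1 (hR₂A W hW) (Finset.mem_coe.1 h) ha₀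
  have hsand₂ := SandwichSet.lemma3_sandwich_set u a₀ a₂ b S 𝓕₂ hlo₂ hhi₂ (hmin a₂ ha₂)
  have hpart₀₂ := real_inter_blockSandwichFamily u S a₀ a₂ R₂ hR₂a₂ (openConn a₀ b)
  have hpart₂₂ := real_inter_blockSandwichFamily u S a₀ a₂ R₂ hR₂a₂ (openConn a₂ b)
  have hbot₂ : ((⋃ s ∈ S, openConn s a₂) ∩ (⋃ s ∈ S, openConn s a₀)ᶜ : Set (BondConfig (Fin n))) = A2 ∩ Xsᶜ := by
    rw [hXs']
  rw [hbot₂] at hpart₀₂ hpart₂₂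
  rw [hpart₀₂, hpart₂₂] at hsand₂
  -- against `a₃`
  set 𝓕₃ : Set (Set (Fin n)) := {T : Set (Fin n) | a₃ ∈ T ∧ a₀ ∉ T} ∪ {T | ∃ W ∈ R₃, T = (W : Set (Fin n))} with h𝓕₃
  have hlo₃ : ∀ ω : BondConfig (Fin n), a₃ ∈ (⋃ s ∈ S, openCluster ω s) → a₀ ∉ (⋃ s ∈ S, openCluster ω s) →
      (⋃ s ∈ S, openCluster ω s) ∈ 𝓕₃ := fun ω h3 h0 => Or.inl ⟨h3, h0⟩
  have hhi₃ : ∀ ω : BondConfig (Fin n), (⋃ s ∈ S, openCluster ω s) ∈ 𝓕₃ → a₀ ∉ (⋃ s ∈ S, openCluster ω s) := by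
    rintro ω (⟨-, h0⟩ | ⟨W, hW, hWe⟩)
    · exact h0
    · rw [hWe]
      exact fun h => Finset.disjoint_left.1 (hR₃A W hW) (Finset.mem_coe.1 h) ha₀
  have hsand₃ := SandwichSet.lemma3_sandwich_set u a₀ a₃ b S 𝓕₃ hlo₃ hhi₃ (hmin a₃ ha₃)
  have hpart₀₃ := real_inter_blockSandwichFamily u S a₀ a₃ R₃ hR₃a₃ (openConn a₀ b)
  have hpart₃₃ := real_inter_blockSandwichFamily u S a₀ a₃ R₃ hR₃a₃ (openConn a₃ b)
  have hbot₃ : ((⋃ s ∈ S, openConn s a₃) ∩ (⋃ s ∈ S, openConn s a₀)ᶜ : Set (BondConfig (Fin n))) = A3 ∩ Xsᶜ := by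
    rw [hXs']
  rw [hbot₃] at hpart₀₃ hpart₃₃
  rw [hpart₀₃, hpart₃₃] at hsand₃
  -- (S8) `Σ_𝒟 f₀ = Σ_𝒟 min(f₀,f₂,f₃) + Σ_{R₂} (f₀ − f₂) + Σ_{R₃} (f₀ − f₃)`
  have hS8 : ∑ W ∈ 𝒟, f₀ W = ∑ W ∈ 𝒟, min (min (f₀ W) (f₂ W)) (f₃ W)
      + (∑ W ∈ R₂, f₀ W - ∑ W ∈ R₂, f₂ W) + (∑ W ∈ R₃, f₀ W - ∑ W ∈ R₃, f₃ W) := by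
    have hpt : ∀ W, f₀ W = min (min (f₀ W) (f₂ W)) (f₃ W)
        + ((if (f₂ W < f₀ W ∧ f₂ W ≤ f₃ W) then f₀ W - f₂ W else 0)
        + (if (f₃ W < f₀ W ∧ f₃ W < f₂ W) then f₀ W - f₃ W else 0)) := by
      intro W
      by_cases h2 : f₂ W < f₀ W ∧ f₂ W ≤ f₃ W
      · have h3 : ¬ (f₃ W < f₀ W ∧ f₃ W < f₂ W) := fun h => absurd h.2 (not_lt.2 h2.2)
        rw [if_pos h2, if_neg h3, min_eq_right h2.1.le, min_eq_left h2.2]; ring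
      · by_cases h3 : f₃ W < f₀ W ∧ f₃ W < f₂ W
        · rw [if_neg h2, if_pos h3, min_eq_right (le_min h3.1.le h3.2.le)]; ring
        · rw [if_neg h2, if_neg h3]
          have h02 : f₀ W ≤ f₂ W := by
            by_contra hc
            push Not at hc
            have h32 : f₃ W < f₂ W := by
              by_contra hc'
              exact h2 ⟨hc, not_lt.1 hc'⟩
            have h30 : f₃ W < f₀ W := h32.trans hc
            exact h3 ⟨h30, h32⟩
          have h03 : f₀ W ≤ f₃ W := by
            by_contra hc
            push Not at hc
            exact h3 ⟨hc, hc.trans_le h02⟩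
          rw [min_eq_left h02, min_eq_left h03]; ring
    have hRsum₂ : ∑ W ∈ R₂, f₀ W - ∑ W ∈ R₂, f₂ W
        = ∑ W ∈ 𝒟, (if (f₂ W < f₀ W ∧ f₂ W ≤ f₃ W) then f₀ W - f₂ W else 0) := by
      rw [← Finset.sum_sub_distrib, hR₂, Finset.sum_filter]
    have hRsum₃ : ∑ W ∈ R₃, f₀ W - ∑ W ∈ R₃, f₃ W
        = ∑ W ∈ 𝒟, (if (f₃ W < f₀ W ∧ f₃ W < f₂ W) then f₀ W - f₃ W else 0) := by
      rw [← Finset.sum_sub_distrib, hR₃, Finset.sum_filter]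
    rw [hRsum₂, hRsum₃, ← Finset.sum_add_distrib, ← Finset.sum_add_distrib]
    exact Finset.sum_congr rfl fun W _ => (hpt W).trans (add_assoc _ _ _).symm
  -- combine
  have hsumR₀₂ : ∑ W ∈ R₂, μ.real ({ω : BondConfig (Fin n) | ∀ z : Fin n, (z ∈ W ↔ ω ∈ ⋃ s ∈ S, openConn s z)} ∩
      openConn a₀ b) = ∑ W ∈ R₂, f₀ W := rfl
  have hsumR₂₂ : ∑ W ∈ R₂, μ.real ({ω : BondConfig (Fin n) | ∀ z : Fin n, (z ∈ W ↔ ω ∈ ⋃ s ∈ S, openConn s z)} ∩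
      openConn a₂ b) = ∑ W ∈ R₂, f₂ W := rfl
  have hsumR₀₃ : ∑ W ∈ R₃, μ.real ({ω : BondConfig (Fin n) | ∀ z : Fin n, (z ∈ W ↔ ω ∈ ⋃ s ∈ S, openConn s z)} ∩
      openConn a₀ b) = ∑ W ∈ R₃, f₀ W := rfl
  have hsumR₃₃ : ∑ W ∈ R₃, μ.real ({ω : BondConfig (Fin n) | ∀ z : Fin n, (z ∈ W ↔ ω ∈ ⋃ s ∈ S, openConn s z)} ∩
      openConn a₃ b) = ∑ W ∈ R₃, f₃ W := rfl
  rw [hsumR₀₂, hsumR₂₂] at hsand₂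
  rw [hsumR₀₃, hsumR₃₃] at hsand₃
  simp only [hKW, h𝒟] at hsum1
  linarith [hsum1, hP3, hτ, hYd, hQ3, hP2, hsand₂, hsand₃, hS8]

/-- **`stub_blockGoodTwo` at `A.card = 4` (three relays besides the target), up to the double-hit defect.**
The registered two-vertex kernel of `stub_goodStep` (TTRL variant V1433: verbatim hypotheses) with the conclusion
weakened by `μ(Dbl)`, `Dbl = {a₀ ∉ K, a₂ ∈ K, a₃ ∈ K, a₂ ↔ b, a₃ ↔ b}`, `K = C(v) ∪ C(u₁)`, where `a₂, a₃` are the two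
relays of `A` other than `a₀` and `b`.  The badness hypotheses are not needed.
[cite: KozmaNitzan2024, §3.2 (Definition p. 12), Lemma 3 (pp. 6–7), Question 7 (p. 36)] -/
theorem blockGoodTwo_cardFour_doubleHit (u : Sym2 (Fin n) → unitInterval) (A : Finset (Fin n))
    (b a₀ a₂ a₃ v u₁ : Fin n) (sel : Finset (Fin n) → Fin n)
    (hbA : b ∈ A) (ha₀ : a₀ ∈ A) (ha₂ : a₂ ∈ A) (ha₃ : a₃ ∈ A)
    (hA : ∀ a ∈ A, a = a₀ ∨ a = a₂ ∨ a = a₃ ∨ a = b) (hsel : ∀ W, sel W ∈ A)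
    (hmin : ∀ a ∈ A, (prodBernoulli u).real (openConn a₀ b) ≤ (prodBernoulli u).real (openConn a b)) :
    (prodBernoulli u).real (openConn a₀ b)
        + (prodBernoulli u).real ((openConn a₀ b)ᶜ ∩ (openConn a₀ v ∪ openConn a₀ u₁)
            ∩ (openConn v b ∪ openConn u₁ b))
      ≤ (prodBernoulli u).real (openConn v b ∪ openConn u₁ b)
        + ∑ W' ∈ (Finset.univ : Finset (Finset (Fin n))).filter (fun W' => Disjoint W' A),
            (prodBernoulli u).real
                {ω : BondConfig (Fin n) | ∀ z : Fin n, (z ∈ W' ↔ ω ∈ openConn v z ∪ openConn u₁ z)}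
              * (prodBernoulli u).real (openConnIn ((W' : Set (Fin n))ᶜ) (sel W') b)
        + (prodBernoulli u).real
            ((openConn v a₀ ∪ openConn u₁ a₀)ᶜ ∩ (openConn v a₂ ∪ openConn u₁ a₂) ∩ (openConn v a₃ ∪ openConn u₁ a₃)
              ∩ openConn a₂ b ∩ openConn a₃ b) := by
  have h := blockGood_threeRelays_doubleHit u A {v, u₁} b a₀ a₂ a₃ sel hbA ha₀ ha₂ ha₃ hA
    ⟨v, Finset.mem_insert_self v {u₁}⟩ hsel hmin
  simp only [blockGrowth_biUnion_pair_left, blockGrowth_biUnion_pair_right] at h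
  exact h

/-- **`stub_blockGoodTwo` at `A.card = 4` OFF the double hit.**  In the shape of the registered kernel (TTRL variant
V1433, verbatim hypotheses and conclusion, `A.card = 4`): if the block `{v, u₁}` never reaches both relays other than
`a₀, b` while missing `a₀` with both of them joined to `b` — `μ(Dbl) = 0` for every labelling `a₂, a₃` of those two
relays — then the kernel inequality holds.  (For `A.card ≤ 3` it holds outright: `blockGoodTwo_cardLeThree`.)
[cite: KozmaNitzan2024, §3.2 (Definition p. 12), Lemma 3 (pp. 6–7), Question 7 (p. 36)] -/
theorem blockGoodTwo_cardFour_of_noDoubleHit (u : Sym2 (Fin n) → unitInterval) (A : Finset (Fin n))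
    (b a₀ v u₁ : Fin n) (sel : Finset (Fin n) → Fin n)
    (hbA : b ∈ A) (ha₀ : a₀ ∈ A) (hA4 : A.card = 4) (hsel : ∀ W, sel W ∈ A)
    (hmin : ∀ a ∈ A, (prodBernoulli u).real (openConn a₀ b) ≤ (prodBernoulli u).real (openConn a b))
    (hDbl : ∀ a₂ ∈ A, ∀ a₃ ∈ A, a₂ ≠ a₃ → a₂ ≠ a₀ → a₂ ≠ b → a₃ ≠ a₀ → a₃ ≠ b →
      (prodBernoulli u).real
          ((openConn v a₀ ∪ openConn u₁ a₀)ᶜ ∩ (openConn v a₂ ∪ openConn u₁ a₂) ∩ (openConn v a₃ ∪ openConn u₁ a₃)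
            ∩ openConn a₂ b ∩ openConn a₃ b) = 0) :
    (prodBernoulli u).real (openConn a₀ b)
        + (prodBernoulli u).real ((openConn a₀ b)ᶜ ∩ (openConn a₀ v ∪ openConn a₀ u₁)
            ∩ (openConn v b ∪ openConn u₁ b))
      ≤ (prodBernoulli u).real (openConn v b ∪ openConn u₁ b)
        + ∑ W' ∈ (Finset.univ : Finset (Finset (Fin n))).filter (fun W' => Disjoint W' A),
            (prodBernoulli u).real
                {ω : BondConfig (Fin n) | ∀ z : Fin n, (z ∈ W' ↔ ω ∈ openConn v z ∪ openConn u₁ z)}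
              * (prodBernoulli u).real (openConnIn ((W' : Set (Fin n))ᶜ) (sel W') b) := by
  by_cases hab : a₀ = b
  · -- the designated relay is the target: at most three relays matter, and the `≤ 3` theorem does not apply
    -- directly, but the target-minimiser lemma does
    subst hab
    have hbb : (openConn a₀ a₀ : Set (BondConfig (Fin n))) = Set.univ :=
      Set.eq_univ_of_forall fun ω => (SimpleGraph.Reachable.refl a₀ : (openGraph ω).Reachable a₀ a₀)
    have h0 : (prodBernoulli u).real ((openConn a₀ a₀)ᶜ ∩ (openConn a₀ v ∪ openConn a₀ u₁)
        ∩ (openConn v a₀ ∪ openConn u₁ a₀)) = 0 := by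
      rw [hbb, Set.compl_univ, Set.empty_inter, Set.empty_inter, measureReal_empty]
    have h := blockGood_of_target_min u A {v, u₁} a₀ sel ⟨v, Finset.mem_insert_self v {u₁}⟩ hsel hmin
    simp only [blockGrowth_biUnion_pair_left] at h
    rw [h0, add_zero, hbb, probReal_univ]
    exact h
  · -- name the two relays besides `a₀` and `b`
    set A' : Finset (Fin n) := (A.erase a₀).erase b with hA'
    have hb' : b ∈ A.erase a₀ := Finset.mem_erase.2 ⟨fun h => hab h.symm, hbA⟩
    have hcard : A'.card = 2 := by
      have h1 : (A.erase a₀).card = A.card - 1 := Finset.card_erase_of_mem ha₀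
      have h2 : A'.card = (A.erase a₀).card - 1 := Finset.card_erase_of_mem hb'
      omega
    have hmemA' : ∀ a, a ∈ A' ↔ a ∈ A ∧ a ≠ a₀ ∧ a ≠ b := fun a => by
      simp only [hA', Finset.mem_erase]; tauto
    obtain ⟨a₂, a₃, h23, hA'eq⟩ := Finset.card_eq_two.1 hcard
    have ha₂' : a₂ ∈ A' := by rw [hA'eq]; exact Finset.mem_insert_self _ _
    have ha₃' : a₃ ∈ A' := by rw [hA'eq]; exact Finset.mem_insert_of_mem (Finset.mem_singleton_self _)
    obtain ⟨ha₂, h20, h2b⟩ := (hmemA' a₂).1 ha₂'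
    obtain ⟨ha₃, h30, h3b⟩ := (hmemA' a₃).1 ha₃'
    have hA : ∀ a ∈ A, a = a₀ ∨ a = a₂ ∨ a = a₃ ∨ a = b := by
      intro a ha
      by_cases h1 : a = a₀
      · exact Or.inl h1
      by_cases h2 : a = b
      · exact Or.inr (Or.inr (Or.inr h2))
      have haA' : a ∈ A' := (hmemA' a).2 ⟨ha, h1, h2⟩
      rw [hA'eq, Finset.mem_insert, Finset.mem_singleton] at haA'
      rcases haA' with rfl | rfl
      · exact Or.inr (Or.inl rfl)
      · exact Or.inr (Or.inr (Or.inl rfl))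
    have h := blockGoodTwo_cardFour_doubleHit u A b a₀ a₂ a₃ v u₁ sel hbA ha₀ ha₂ ha₃ hA hsel hmin
    rw [hDbl a₂ ha₂ a₃ ha₃ h23 h20 h2b h30 h3b, add_zero] at h
    exact h

end BlockGoodThreeRelays

open Literature.Probability.LatticeModels Literature.Probability.Percolation in
/-- Registered helper stub `stub_blockGoodTwoCardFourDoubleHit_v1433` (TTRL deep seat v1433): **the registered kernel
`stub_blockGoodTwo` at three relays besides the target, up to the double-hit defect** (= `blockGoodTwo_cardFour_doubleHit`).
[cite: KozmaNitzan2024, §3.2 (Definition p. 12, Question 7 p. 36), Lemma 3 (pp. 6–7)] -/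
theorem stub_blockGoodTwoCardFourDoubleHit_v1433 : ∀ (n : ℕ) (u : Sym2 (Fin n) → unitInterval) (A : Finset (Fin n)) (b a₀ a₂ a₃ v u₁ : Fin n) (sel : Finset (Fin n) → Fin n), b ∈ A → a₀ ∈ A → a₂ ∈ A → a₃ ∈ A → (∀ a ∈ A, a = a₀ ∨ a = a₂ ∨ a = a₃ ∨ a = b) → (∀ W, sel W ∈ A) → (∀ a ∈ A, (prodBernoulli u).real (openConn a₀ b) ≤ (prodBernoulli u).real (openConn a b)) → (prodBernoulli u).real (openConn a₀ b) + (prodBernoulli u).real ((openConn a₀ b)ᶜ ∩ (openConn a₀ v ∪ openConn a₀ u₁) ∩ (openConn v b ∪ openConn u₁ b)) ≤ (prodBernoulli u).real (openConn v b ∪ openConn u₁ b) + ∑ W' ∈ (Finset.univ : Finset (Finset (Fin n))).filter (fun W' => Disjoint W' A), (prodBernoulli u).real {ω : BondConfig (Fin n) | ∀ z : Fin n, (z ∈ W' ↔ ω ∈ openConn v z ∪ openConn u₁ z)} * (prodBernoulli u).real (openConnIn ((W' : Set (Fin n))ᶜ) (sel W') b) + (prodBernoulli u).real ((openConn v a₀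 ∪ openConn u₁ a₀)ᶜ ∩ (openConn v a₂ ∪ openConn u₁ a₂) ∩ (openConn v a₃ ∪ openConn u₁ a₃) ∩ openConn a₂ b ∩ openConn a₃ b) :=
  fun _ u A b a₀ a₂ a₃ v u₁ sel hbA ha₀ ha₂ ha₃ hA hsel hmin =>
    blockGoodTwo_cardFour_doubleHit u A b a₀ a₂ a₃ v u₁ sel hbA ha₀ ha₂ ha₃ hA hsel hmin

end

end Summit.CriticalPhenomena.PercolationContinuityZ3.Theorems
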